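/-
Copyright (c) 2026 the pub-hodgecm-mathlib formalisation cell (harness21).  Prover seat hodgecm-mathlib-K2Liu-p12 (g3): Track B «K2-LIT»,
#184♮ = hLiu418 = stmt-HodgeConjecture-24832; Road Φ of socket #41, Φ9 consumer sheet row G2 (K2E5-plan (g7) deal (b) 2026-09-04T11:53:45Z,
LEAD F0P6-plan (g14) 11:33:17Z); census `K2/K2Liu-p12/g3/CENSUS-G2b-GoodPlaceWhittakerEulerAssembly.K2Liu-p12-g3.md`.
-/
import Summits.HodgeConjecture.HodgeConjecture.Theorems.K2LiuSiegelIntertwiningScalarGL1   -- ★ O41.6 `hasProd_b`, `differentiableOn_b`, §7 CM pattern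
import Mathlib.Topology.Algebra.InfiniteSum.Basic
import Mathlib.Analysis.Calculus.Deriv.Mul
import HarnessLib

/-!
# Crux `HLiu418`, Road Φ of socket #41, Φ9 sheet row G2 — THE GOOD-PLACE EULER FACTOR OF THE FOURIER COEFFICIENT:
# `∏'_{v ∉ D(β) ∪ T} W°_{β,v}(1,s) ∕ μ_v(B_v(0)) = (b^{D(β)∪T}(s))⁻¹` on `{0 < re s}`

Cell `hodgecm-mathlib`, crux item hLiu418 = `stmt-HodgeConjecture-24832`, route of record `HCCMUnconditional`; squad K2 ∕ K2Liu, road `K2_Liu`,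
socket #41 `sig_K2LiuSiegelEisensteinContinuation`, Road Φ; consumer = the Φ9 sheet `CENSUS-41-Phi9-ConsumerSheet` row G2 (face
`∏'_{v∉T} W° = (b^T(s))⁻¹ · ∏_{v∈D(β)∖T} (…)`, amendments (A-13)–(A-15)).  THEOREMS ONLY (no `def`, no `instance`, no `notation`, no named-fact
hypothesis, no `sorry`); lane `--supports stmt-HodgeConjecture-24832` (count-neutral helper; closes no socket by itself).

THE MATHEMATICS.  For a rank-2 Fourier index `β` of the Siegel Eisenstein series on `U(2,2)`, let `T ⊇ T₀` be the finite set of bad places and `D(β)`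
the finite set of places where `β` is not `v`-unimodular; put `U = D(β) ∪ T`.  At every `v ∉ U` the spherical local Whittaker coefficient is
★ E7 `K2LiuGoodPlaceWhittakerUnimodularValueCM` §6: `W°_{β,v}(1,s) = μ_v(B_v(0)) · (1 − q_v^{−(2s+1)})(1 − ε(ϖ_v) q_v^{−(2s+2)})` (`ε = χ|_{𝔸_F^×}`, parity),
i.e. `μ_v(B_v(0))` times the INVERSE of the `v`-factor of `b^U(s) = ζ_F^U(2s+1) · L^U(2s+2, ε)` (★ O41.6 `hasProd_b`).  Hence, on #41's window `{0 < re s}`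
where `b^U` converges absolutely and has no zero:
* §1 `hasProd_localFactor`: `∏'_{v∉U} (1 − q_v^{−(2s+1)})(1 − ε(ϖ_v) q_v^{−(2s+2)}) = (b^U(s))⁻¹` as a `HasProd` (★ `hasProd_b` inverted through `Tendsto.inv₀`,
  the pattern of ★ `hasProd_localScalar`), with `tprod`∕`Multipliable` forms;
* §2 the BY-VALUE Whittaker form: for numbers `W v` (`= W°_{β,v}(1,s)`) and volumes `m v` (`= μ_v(B_v(0))`) satisfying the E7 letter `hW` off `U`,
  `∏'_{v∉U} W v ∕ m v = (b^U(s))⁻¹`; normalised twin (`m v = 1` off `U`, Φ3c's `ν_v(K_{H,v} ∩ N_Δ(F_v)) = 1`): `∏'_{v∉U} W v = (b^U(s))⁻¹`;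
* §3 ROW G2'S FACE — the finitely many `v ∈ D(β)∖T` carried BY VALUE (their bound is (A-13)'s `hWbound`, not used here):
  `HasProd (v ∉ T ↦ W v ∕ m v) ((b^{D∪T}(s))⁻¹ · ∏_{v∈D∖T} W v ∕ m v)` (Mathlib `HasProd.mul_compl` on `{v ∉ T}` + `Equiv.hasProd_iff`);
* §4 HOLOMORPHY on the window: `s ↦ (b^U(s))⁻¹` (★ `differentiableOn_b` + non-vanishing) and `s ↦ (b^{D∪T}(s))⁻¹ · ∏_{v∈D∖T} W_v(s) ∕ m_v` are holomorphic
  on `{0 < re s}` (the `W_v`, `v ∈ D∖T`, holomorphic there BY VALUE: ★ Φ4 (R-bound) ∕ Φ5 entire local coefficients);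
* §5 the CM twins at the K2_Liu frame `F = L⁺`, `ε = ε_{L/L⁺} =` ★ `quadraticHeckeCharCM L` (unitary: finite order ★ `isFiniteOrder_quadraticHeckeCharCM`, the O41.6 §7 pattern).
NOT HERE: the per-place discharge of `hW` (★ E7 §6 + the parity letter ★ `IsSplittingChar`, done by the G1∕Φ3d head at its local letters) and the
`β`-uniform majorant of `(b^{D(β)∪T})⁻¹` ((A-13)∕(H2) slot of ★ `summable_lattice_prod_majorant`).
HONEST LABEL.  Count-neutral helper; it retires nothing by itself: `HC_CM` is proved only modulo the 7 printed citations (2 remaining named inputs: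
hLiu418 = `stmt-HodgeConjecture-24832`, h413 = `stmt-HodgeConjecture-24833`) until rung 0 closes.

## References
* [Liu2011] Y. Liu, *Arithmetic theta lifting and L-derivatives for unitary groups, I*, Algebra Number Theory 5 (2011): §2A p. 936 (2-10)
  (`W_T(e, φ°) = 1∕b` at unimodular `T`), (2-2) (`b_m(s)`).
* [KudlaRallis1994] S. Kudla, S. Rallis, Ann. of Math. 140 (1994): §1 (Euler product of the Fourier coefficients of Siegel Eisenstein series).
* [Tan1999] V. Tan, Canad. J. Math. 51 (1999): §2–§3.   * [HarrisKudlaSweet1996] M. Harris, S. Kudla, W. J. Sweet, J. AMS 9 (1996): §6 (6.16).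
* [NeukirchANT1999] J. Neukirch, *Algebraic Number Theory* (1999): Ch. VII §8 (absolute convergence of Hecke `L`-series on `Re > 1`).
-/

set_option autoImplicit false
set_option linter.dupNamespace false -- the mandated namespace repeats `HodgeConjecture.HodgeConjecture`

noncomputable section

open scoped NNReal Topology
open Filter Complex NumberField IsDedekindDomain
open Literature.NumberTheory.Automorphic Literature.NumberTheory.LFunctions Literature.NumberTheory.GaloisRepresentations
open Summit.HodgeConjecture.HodgeConjecture.Cruxes.HLiu418.K2LiuSiegelIntertwiningScalarGL1

namespace Summit.HodgeConjecture.HodgeConjecture.Cruxes.HLiu418.K2LiuGoodPlaceWhittakerEulerAssembly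

variable {F : Type} [Field F] [NumberField F]

/-! ## §1 `∏'_{v∉U} (1 − q_v^{−(2s+1)})(1 − ε(ϖ_v) q_v^{−(2s+2)}) = (b^U(s))⁻¹` on `{0 < re s}` -/

section LocalFactor

variable {ε : HeckeCharacter F} {U : Set (HeightOneSpectrum (𝓞 F))}

/-- **THE GOOD-PLACE EULER FACTOR OF Φ9.**  For a unitary Hecke character `ε` of `F`, any set `U` of finite places (read `D(β) ∪ T`) and `0 < re s`:
the local factors `(1 − q_v^{−(2s+1)})(1 − ε(ϖ_v) q_v^{−(2s+2)})` — `W°_{β,v}(1,s)∕μ_v(B_v(0))` at a `β`-unimodular good place `v` by ★ E7 §6 — have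
`HasProd` over `v ∉ U` equal to `(b^U(s))⁻¹`, `b^U(s) = ζ_F^U(2s+1)·L^U(2s+2, ε)` (★ O41.6 `hasProd_b`, inverted: partial products of inverses are inverses of
partial products, `b^U(s) ≠ 0`, `Tendsto.inv₀`); and `b^U(s) ≠ 0`. [cite: Liu2011, §2A (2-10)] [cite: KudlaRallis1994, §1] [cite: NeukirchANT1999, Ch. VII §8] -/
theorem hasProd_localFactor (hε : ε.IsUnitary) {s : ℂ} (hs : 0 < s.re) :
    HasProd (fun v : {v : HeightOneSpectrum (𝓞 F) // v ∉ U} =>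
        (1 - (v.1.residueCard : ℂ) ^ (-(2 * s + 1))) * (1 - ε.valueAtUniformizer v.1 * (v.1.residueCard : ℂ) ^ (-(2 * s + 2))))
      (partialStandardL U (fun _ => {1}) (2 * s + 1) * partialStandardL U (fun v => {ε.valueAtUniformizer v}) (2 * s + 2))⁻¹ ∧
    partialStandardL U (fun _ => {1}) (2 * s + 1) * partialStandardL U (fun v => {ε.valueAtUniformizer v}) (2 * s + 2) ≠ 0 := by
  obtain ⟨hb, hb0⟩ := hasProd_b (S := U) hε hs
  refine ⟨?_, hb0⟩
  have hbinv : HasProd (fun v : {v : HeightOneSpectrum (𝓞 F) // v ∉ U} =>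
      ((1 - (v.1.residueCard : ℂ) ^ (-(2 * s + 1)))⁻¹ *
        (1 - ε.valueAtUniformizer v.1 * (v.1.residueCard : ℂ) ^ (-(2 * s + 2)))⁻¹)⁻¹)
      (partialStandardL U (fun _ => {1}) (2 * s + 1) * partialStandardL U (fun v => {ε.valueAtUniformizer v}) (2 * s + 2))⁻¹ := by
    unfold HasProd at hb ⊢
    simpa only [Finset.prod_inv_distrib] using hb.inv₀ hb0
  refine hbinv.congr_fun fun v => ?_
  rw [mul_inv, inv_inv, inv_inv]

/-- `Multipliable` form of `hasProd_localFactor`. [cite: Liu2011, §2A (2-10)] -/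
theorem multipliable_localFactor (hε : ε.IsUnitary) {s : ℂ} (hs : 0 < s.re) :
    Multipliable (fun v : {v : HeightOneSpectrum (𝓞 F) // v ∉ U} =>
        (1 - (v.1.residueCard : ℂ) ^ (-(2 * s + 1))) * (1 - ε.valueAtUniformizer v.1 * (v.1.residueCard : ℂ) ^ (-(2 * s + 2)))) :=
  (hasProd_localFactor hε hs).1.multipliable

/-- **`tprod` form**: `∏'_{v∉U} (1 − q_v^{−(2s+1)})(1 − ε(ϖ_v) q_v^{−(2s+2)}) = (b^U(s))⁻¹`, `0 < re s`. [cite: Liu2011, §2A (2-10)] [cite: KudlaRallis1994, §1] -/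
theorem tprod_localFactor_eq (hε : ε.IsUnitary) {s : ℂ} (hs : 0 < s.re) :
    ∏' v : {v : HeightOneSpectrum (𝓞 F) // v ∉ U},
        (1 - (v.1.residueCard : ℂ) ^ (-(2 * s + 1))) * (1 - ε.valueAtUniformizer v.1 * (v.1.residueCard : ℂ) ^ (-(2 * s + 2))) =
      (partialStandardL U (fun _ => {1}) (2 * s + 1) * partialStandardL U (fun v => {ε.valueAtUniformizer v}) (2 * s + 2))⁻¹ :=
  (hasProd_localFactor hε hs).1.tprod_eq

/-! ## §2 The by-value Whittaker form: `∏'_{v∉U} W v ∕ m v = (b^U(s))⁻¹` -/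

/-- **`∏'_{v∉U} W°_{β,v}(1,s) ∕ μ_v(B_v(0)) = (b^U(s))⁻¹`, BY VALUE.**  If off `U` the numbers `W v` and the volumes `m v ≠ 0` satisfy the letter of ★ E7 §6
(`setIntegral_whittaker_unimodular_eq_of_parity_inert∕_split` after `α = ε(ϖ_v)`): `W v = m v · (1 − q_v^{−(2s+1)})(1 − ε(ϖ_v) q_v^{−(2s+2)})`, then
`HasProd (v ∉ U ↦ W v ∕ m v) (b^U(s))⁻¹` for `0 < re s`. [cite: Liu2011, §2A (2-10)] [cite: KudlaRallis1994, §1] -/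
theorem hasProd_whittaker_div_vol (hε : ε.IsUnitary) {s : ℂ} (hs : 0 < s.re) {W : HeightOneSpectrum (𝓞 F) → ℂ} {m : HeightOneSpectrum (𝓞 F) → ℝ}
    (hm : ∀ v, v ∉ U → m v ≠ 0)
    (hW : ∀ v, v ∉ U → W v = (m v : ℂ) *
      ((1 - (v.residueCard : ℂ) ^ (-(2 * s + 1))) * (1 - ε.valueAtUniformizer v * (v.residueCard : ℂ) ^ (-(2 * s + 2))))) :
    HasProd (fun v : {v : HeightOneSpectrum (𝓞 F) // v ∉ U} => W v.1 / (m v.1 : ℂ))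
      (partialStandardL U (fun _ => {1}) (2 * s + 1) * partialStandardL U (fun v => {ε.valueAtUniformizer v}) (2 * s + 2))⁻¹ := by
  refine (hasProd_localFactor hε hs).1.congr_fun fun v => ?_
  have hm0 : (m v.1 : ℂ) ≠ 0 := by exact_mod_cast hm v.1 v.2
  rw [hW v.1 v.2, mul_div_cancel_left₀ _ hm0]

/-- **normalised twin** (`μ_v(B_v(0)) = 1` off `U` — the local Haar measures of ★ Φ3c `integral_unipDelta_eq_mul_tprod` give the integral points volume `1`):
`HasProd (v ∉ U ↦ W v) (b^U(s))⁻¹`. [cite: Liu2011, §2A (2-10)] [cite: Tan1999, §2] -/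
theorem hasProd_whittaker_of_vol_eq_one (hε : ε.IsUnitary) {s : ℂ} (hs : 0 < s.re) {W : HeightOneSpectrum (𝓞 F) → ℂ}
    (hW : ∀ v, v ∉ U → W v =
      (1 - (v.residueCard : ℂ) ^ (-(2 * s + 1))) * (1 - ε.valueAtUniformizer v * (v.residueCard : ℂ) ^ (-(2 * s + 2)))) :
    HasProd (fun v : {v : HeightOneSpectrum (𝓞 F) // v ∉ U} => W v.1)
      (partialStandardL U (fun _ => {1}) (2 * s + 1) * partialStandardL U (fun v => {ε.valueAtUniformizer v}) (2 * s + 2))⁻¹ :=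
  (hasProd_localFactor hε hs).1.congr_fun fun v => hW v.1 v.2

/-- `tprod` form of the normalised twin: `∏'_{v∉U} W v = (b^U(s))⁻¹`. [cite: Liu2011, §2A (2-10)] -/
theorem tprod_whittaker_of_vol_eq_one (hε : ε.IsUnitary) {s : ℂ} (hs : 0 < s.re) {W : HeightOneSpectrum (𝓞 F) → ℂ}
    (hW : ∀ v, v ∉ U → W v =
      (1 - (v.residueCard : ℂ) ^ (-(2 * s + 1))) * (1 - ε.valueAtUniformizer v * (v.residueCard : ℂ) ^ (-(2 * s + 2)))) :
    ∏' v : {v : HeightOneSpectrum (𝓞 F) // v ∉ U}, W v.1 =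
      (partialStandardL U (fun _ => {1}) (2 * s + 1) * partialStandardL U (fun v => {ε.valueAtUniformizer v}) (2 * s + 2))⁻¹ :=
  (hasProd_whittaker_of_vol_eq_one hε hs hW).tprod_eq

end LocalFactor

/-! ## §3 Row G2's face: the product over `v ∉ T`, the finitely many `v ∈ D ∖ T` carried by value -/

section Face

variable {ε : HeckeCharacter F} {T D : Set (HeightOneSpectrum (𝓞 F))}

omit [NumberField F] in
/-- generic bookkeeping: a `HasProd` over `{v ∉ D ∪ T}` extends to `{v ∉ T}` by the finite product over `D ∖ T` (Mathlib `HasProd.mul_compl` on the type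
`{v // v ∉ T}` along `{x : {v ∉ T} // x.1 ∉ D} ≃ {v // v ∉ D ∪ T}`). [folklore] -/
theorem hasProd_notMem_of_hasProd_notMem_union {g : HeightOneSpectrum (𝓞 F) → ℂ} {a : ℂ} (hDT : (D \ T).Finite)
    (hg : HasProd (fun v : {v : HeightOneSpectrum (𝓞 F) // v ∉ D ∪ T} => g v.1) a) :
    HasProd (fun v : {v : HeightOneSpectrum (𝓞 F) // v ∉ T} => g v.1) (a * ∏ v ∈ hDT.toFinset, g v) := by
  classical
  -- the finite part: `{x : {v ∉ T} // x.1 ∈ D}`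
  set X := {v : HeightOneSpectrum (𝓞 F) // v ∉ T}
  set A : Set X := {x | x.1 ∈ D} with hA
  have hAfin : A.Finite := by
    refine Set.Finite.of_finite_image (f := fun x : X => x.1) ?_ Subtype.val_injective.injOn
    refine hDT.subset ?_
    rintro _ ⟨x, hx, rfl⟩
    exact ⟨hx, x.2⟩
  -- the product over `A` is the finite product over `D ∖ T`
  have hfinite : HasProd ((fun x : X => g x.1) ∘ ((↑) : A → X)) (∏ v ∈ hDT.toFinset, g v) := by
    have h := hAfin.toFinset.hasProd (fun x : X => g x.1)
    rw [hAfin.coe_toFinset] at h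
    have heq : ∏ x ∈ hAfin.toFinset, g x.1 = ∏ v ∈ hDT.toFinset, g v := by
      refine Finset.prod_nbij (fun x : X => x.1) ?_ ?_ ?_ ?_
      · intro x hx
        rw [Set.Finite.mem_toFinset] at hx ⊢
        exact ⟨hx, x.2⟩
      · exact fun x _ y _ h => Subtype.ext h
      · intro v hv
        rw [Finset.mem_coe, Set.Finite.mem_toFinset] at hv
        exact ⟨⟨v, hv.2⟩, by rw [Finset.mem_coe, Set.Finite.mem_toFinset]; exact hv.1, rfl⟩
      · exact fun _ _ => rfl
    rw [← heq]
    exact h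
  -- the product over `Aᶜ` is the given one, transported along the equivalence with `{v ∉ D ∪ T}`
  let e : (Aᶜ : Set X) ≃ {v : HeightOneSpectrum (𝓞 F) // v ∉ D ∪ T} :=
    { toFun := fun x => ⟨x.1.1, fun h => h.elim (fun hD => x.2 hD) (fun hT => x.1.2 hT)⟩
      invFun := fun v => ⟨⟨v.1, fun hT => v.2 (Or.inr hT)⟩, fun hD => v.2 (Or.inl hD)⟩
      left_inv := fun x => rfl
      right_inv := fun v => rfl }
  have hcompl : HasProd ((fun x : X => g x.1) ∘ ((↑) : (Aᶜ : Set X) → X)) a := by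
    have h2 : ((fun x : X => g x.1) ∘ ((↑) : (Aᶜ : Set X) → X)) =
        (fun v : {v : HeightOneSpectrum (𝓞 F) // v ∉ D ∪ T} => g v.1) ∘ e := by
      funext x; rfl
    rw [h2, Equiv.hasProd_iff]
    exact hg
  have := hfinite.mul_compl hcompl
  rw [mul_comm] at this
  exact this

/-- **ROW G2's FACE: `∏'_{v∉T} W°_{β,v}(1,s)∕μ_v(B_v(0)) = (b^{D∪T}(s))⁻¹ · ∏_{v∈D∖T} W_v∕m_v`**, the finitely many `D ∖ T` factors (good places where `β` is not
unimodular; bounded by (A-13)'s `hWbound`, not needed here) carried BY VALUE; `W`, `m` as in §2 off `D ∪ T`, `0 < re s`.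
[cite: KudlaRallis1994, §1] [cite: Liu2011, §2A (2-10)] [cite: Tan1999, §2] -/
theorem hasProd_whittaker_face (hε : ε.IsUnitary) {s : ℂ} (hs : 0 < s.re) (hDT : (D \ T).Finite)
    {W : HeightOneSpectrum (𝓞 F) → ℂ} {m : HeightOneSpectrum (𝓞 F) → ℝ} (hm : ∀ v, v ∉ D ∪ T → m v ≠ 0)
    (hW : ∀ v, v ∉ D ∪ T → W v = (m v : ℂ) *
      ((1 - (v.residueCard : ℂ) ^ (-(2 * s + 1))) * (1 - ε.valueAtUniformizer v * (v.residueCard : ℂ) ^ (-(2 * s + 2))))) :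
    HasProd (fun v : {v : HeightOneSpectrum (𝓞 F) // v ∉ T} => W v.1 / (m v.1 : ℂ))
      ((partialStandardL (D ∪ T) (fun _ => {1}) (2 * s + 1) * partialStandardL (D ∪ T) (fun v => {ε.valueAtUniformizer v}) (2 * s + 2))⁻¹ *
        ∏ v ∈ hDT.toFinset, W v / (m v : ℂ)) :=
  hasProd_notMem_of_hasProd_notMem_union (g := fun v => W v / (m v : ℂ)) hDT (hasProd_whittaker_div_vol hε hs hm hW)

/-- `tprod` form of row G2's face. [cite: KudlaRallis1994, §1] [cite: Liu2011, §2A (2-10)] -/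
theorem tprod_whittaker_face_eq (hε : ε.IsUnitary) {s : ℂ} (hs : 0 < s.re) (hDT : (D \ T).Finite)
    {W : HeightOneSpectrum (𝓞 F) → ℂ} {m : HeightOneSpectrum (𝓞 F) → ℝ} (hm : ∀ v, v ∉ D ∪ T → m v ≠ 0)
    (hW : ∀ v, v ∉ D ∪ T → W v = (m v : ℂ) *
      ((1 - (v.residueCard : ℂ) ^ (-(2 * s + 1))) * (1 - ε.valueAtUniformizer v * (v.residueCard : ℂ) ^ (-(2 * s + 2))))) :
    ∏' v : {v : HeightOneSpectrum (𝓞 F) // v ∉ T}, W v.1 / (m v.1 : ℂ) =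
      (partialStandardL (D ∪ T) (fun _ => {1}) (2 * s + 1) * partialStandardL (D ∪ T) (fun v => {ε.valueAtUniformizer v}) (2 * s + 2))⁻¹ *
        ∏ v ∈ hDT.toFinset, W v / (m v : ℂ) :=
  (hasProd_whittaker_face hε hs hDT hm hW).tprod_eq

/-! ## §4 Holomorphy on the window `{0 < re s}` -/

/-- **`s ↦ (b^U(s))⁻¹` is holomorphic on `{0 < re s}`** (★ O41.6 `differentiableOn_b`; `b^U(s) ≠ 0` there by ★ `hasProd_b`). [cite: NeukirchANT1999, Ch. VII §8] -/
theorem differentiableOn_inv_b {U : Set (HeightOneSpectrum (𝓞 F))} (hε : ε.IsUnitary) :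
    DifferentiableOn ℂ (fun s : ℂ =>
      (partialStandardL U (fun _ => {1}) (2 * s + 1) * partialStandardL U (fun v => {ε.valueAtUniformizer v}) (2 * s + 2))⁻¹)
      {s : ℂ | 0 < s.re} :=
  (differentiableOn_b (S := U) hε).inv fun _ hs => (hasProd_b (S := U) hε hs).2

/-- **the face value is holomorphic on the window**: if each `W_v`, `v ∈ D ∖ T`, is holomorphic on `{0 < re s}` (★ Φ4 (R-bound)∕Φ5: the local coefficients are
entire — BY VALUE here), then so is `s ↦ (b^{D∪T}(s))⁻¹ · ∏_{v∈D∖T} W_v(s)∕m_v`. [cite: KudlaRallis1994, §1] [cite: NeukirchANT1999, Ch. VII §8] -/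
theorem differentiableOn_face (hε : ε.IsUnitary) (hDT : (D \ T).Finite) {W : HeightOneSpectrum (𝓞 F) → ℂ → ℂ} {m : HeightOneSpectrum (𝓞 F) → ℝ}
    (hWd : ∀ v ∈ hDT.toFinset, DifferentiableOn ℂ (W v) {s : ℂ | 0 < s.re}) :
    DifferentiableOn ℂ (fun s : ℂ =>
      (partialStandardL (D ∪ T) (fun _ => {1}) (2 * s + 1) * partialStandardL (D ∪ T) (fun v => {ε.valueAtUniformizer v}) (2 * s + 2))⁻¹ *
        ∏ v ∈ hDT.toFinset, W v s / (m v : ℂ)) {s : ℂ | 0 < s.re} :=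
  (differentiableOn_inv_b hε).mul (DifferentiableOn.fun_finsetProd fun v hv => (hWd v hv).div_const _)

end Face

/-! ## §5 The CM twins: `F = L⁺`, `ε = ε_{L/L⁺}` -/

section CM

variable (L : Type) [Field L] [NumberField L] [IsCMField L]

/-- **THE GOOD-PLACE EULER FACTOR AT THE K2_Liu FRAME** (`F = L⁺`, `ε = ε_{L/L⁺}`): for `U ⊆ ` finite places of `L⁺` (read `D(β) ∪ T`) and `0 < re s`,
`HasProd (v ∉ U ↦ (1 − q_v^{−(2s+1)})(1 − ε(ϖ_v) q_v^{−(2s+2)})) (b^U(s))⁻¹`, `b^U = ζ_{L⁺}^U(2s+1) L^U(2s+2, ε_{L/L⁺})` — the product of the local values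
`W°_{β,v}(1,s)∕μ_v(B_v(0))` of ★ E7 §6 (`α = ε(ϖ_v) = −1` inert ∕ `+1` split, ★ `K2E1QuadraticHeckeCharCMPlaceValues`). [cite: Liu2011, §2A (2-10)] [cite: KudlaRallis1994, §1] -/
theorem hasProd_localFactor_cm {U : Set (HeightOneSpectrum (𝓞 ↥(maximalRealSubfield L)))} {s : ℂ} (hs : 0 < s.re) :
    HasProd (fun v : {v : HeightOneSpectrum (𝓞 ↥(maximalRealSubfield L)) // v ∉ U} =>
        (1 - (v.1.residueCard : ℂ) ^ (-(2 * s + 1))) *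
          (1 - (quadraticHeckeCharCM L).valueAtUniformizer v.1 * (v.1.residueCard : ℂ) ^ (-(2 * s + 2))))
      (partialStandardL U (fun _ => {1}) (2 * s + 1) *
        partialStandardL U (fun v => {(quadraticHeckeCharCM L).valueAtUniformizer v}) (2 * s + 2))⁻¹ ∧
    partialStandardL U (fun _ => {1}) (2 * s + 1) *
        partialStandardL U (fun v => {(quadraticHeckeCharCM L).valueAtUniformizer v}) (2 * s + 2) ≠ 0 :=
  hasProd_localFactor (Literature.RepresentationTheory.HarrisKudlaSweet1996.isFiniteOrder_quadraticHeckeCharCM (L := L)).isUnitary hs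

/-- **ROW G2's FACE AT THE K2_Liu FRAME**: `HasProd (v ∉ T ↦ W v ∕ m v) ((b^{D∪T}(s))⁻¹ · ∏_{v∈D∖T} W v ∕ m v)` for `W`, `m` with the E7 letter off `D ∪ T`.
[cite: KudlaRallis1994, §1] [cite: Liu2011, §2A (2-10)] -/
theorem hasProd_whittaker_face_cm {T D : Set (HeightOneSpectrum (𝓞 ↥(maximalRealSubfield L)))} {s : ℂ} (hs : 0 < s.re) (hDT : (D \ T).Finite)
    {W : HeightOneSpectrum (𝓞 ↥(maximalRealSubfield L)) → ℂ} {m : HeightOneSpectrum (𝓞 ↥(maximalRealSubfield L)) → ℝ}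
    (hm : ∀ v, v ∉ D ∪ T → m v ≠ 0)
    (hW : ∀ v, v ∉ D ∪ T → W v = (m v : ℂ) * ((1 - (v.residueCard : ℂ) ^ (-(2 * s + 1))) *
      (1 - (quadraticHeckeCharCM L).valueAtUniformizer v * (v.residueCard : ℂ) ^ (-(2 * s + 2))))) :
    HasProd (fun v : {v : HeightOneSpectrum (𝓞 ↥(maximalRealSubfield L)) // v ∉ T} => W v.1 / (m v.1 : ℂ))
      ((partialStandardL (D ∪ T) (fun _ => {1}) (2 * s + 1) *
          partialStandardL (D ∪ T) (fun v => {(quadraticHeckeCharCM L).valueAtUniformizer v}) (2 * s + 2))⁻¹ *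
        ∏ v ∈ hDT.toFinset, W v / (m v : ℂ)) :=
  hasProd_whittaker_face (Literature.RepresentationTheory.HarrisKudlaSweet1996.isFiniteOrder_quadraticHeckeCharCM (L := L)).isUnitary hs hDT hm hW

/-- **holomorphy of the face value at the K2_Liu frame** on `{0 < re s}`. [cite: KudlaRallis1994, §1] [cite: NeukirchANT1999, Ch. VII §8] -/
theorem differentiableOn_face_cm {T D : Set (HeightOneSpectrum (𝓞 ↥(maximalRealSubfield L)))} (hDT : (D \ T).Finite)
    {W : HeightOneSpectrum (𝓞 ↥(maximalRealSubfield L)) → ℂ → ℂ} {m : HeightOneSpectrum (𝓞 ↥(maximalRealSubfield L)) → ℝ}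
    (hWd : ∀ v ∈ hDT.toFinset, DifferentiableOn ℂ (W v) {s : ℂ | 0 < s.re}) :
    DifferentiableOn ℂ (fun s : ℂ =>
      (partialStandardL (D ∪ T) (fun _ => {1}) (2 * s + 1) *
          partialStandardL (D ∪ T) (fun v => {(quadraticHeckeCharCM L).valueAtUniformizer v}) (2 * s + 2))⁻¹ *
        ∏ v ∈ hDT.toFinset, W v s / (m v : ℂ)) {s : ℂ | 0 < s.re} :=
  differentiableOn_face (Literature.RepresentationTheory.HarrisKudlaSweet1996.isFiniteOrder_quadraticHeckeCharCM (L := L)).isUnitary hDT hWd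

end CM

end Summit.HodgeConjecture.HodgeConjecture.Cruxes.HLiu418.K2LiuGoodPlaceWhittakerEulerAssembly

end
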